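import Summits.ValiantsHypothesis.ValiantsHypothesis.Theorems.DefinabilityGapPivotLive
import HarnessLib

/-!
# DefinabilityGap — pivot certificates: HEAVY cells, admissible rows, and self-protection

Route `route-ValiantsHypothesis-DefinabilityGap`, residual crux `KIPlantedHitting` (item 23547),
rung `R_K1.1`, ROAD P, existence step N1 (NODE-v7 §H (a)).  For a curve `c ∈ T` and a position
`p`, the CO-CURVES of `c` at `p` are the `c' ∈ T`, `c' ≠ c`, whose block has the same cell at
`p` (`coCurves`; a shared cell always sits at the same position).  Two facts drive the row rule
of N1:
* COUNTING (`sum_card_coCurves_le`): `Σ_p #coCurves T c p ≤ 2 (#T − 1)` — every other curve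
  meets `c` in at most two cells (the design property) — hence at most `2(#T−1)/M` cells of `c`
  are `M`-HEAVY (`≥ M` co-curves), and at most that many ROWS of `c` contain a heavy cell
  (`mul_card_heavyCells_le`, `mul_card_heavyRows_le`): excluding them leaves many admissible rows.
* SELF-PROTECTION (`not_mem_pivotZeros_of_heavy`): heaviness is a property of the CELL, so if no
  curve of `T` takes its pivot row among its own heavy rows, then NO heavy cell of any curve is
  ever a gadget zero — gadget zeros live in pivot rows, and a co-curve killing a heavy cell of `c`
  would be pivoting in one of its own heavy rows.
So under the rule «`r c ∉ heavyRows T c M`» only cells with fewer than `M` co-curves can be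
killed; what remains of N1 is the probabilistic choice of the rows among the admissible ones.
-/

noncomputable section

open Finset
open Literature.Computability.AlgebraicComplexity Literature.Computability.MetaComplexity
open Summit.ValiantsHypothesis.ValiantsHypothesis.Theorems.DefinabilityGapAffineRung
open Summit.ValiantsHypothesis.ValiantsHypothesis.Theorems.DefinabilityGapSupportRung
open Summit.ValiantsHypothesis.ValiantsHypothesis.Theorems.DefinabilityGapPivotCertificate
open Summit.ValiantsHypothesis.ValiantsHypothesis.Theorems.DefinabilityGapPivotLive

namespace Summit.ValiantsHypothesis.ValiantsHypothesis.Theorems.DefinabilityGapPivotAdmissible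

variable {m : ℕ}

/-! ## 1. Co-curves at a position and the incidence count -/

/-- The co-curves of `c` at position `p`: curves `c' ∈ T`, `c' ≠ c`, whose block carries the
same cell at `p`. [this file] -/
def coCurves (T : Finset (Fin 3 → Fin (qOf m))) (c : Fin 3 → Fin (qOf m)) (p : Fin m × Fin m) :
    Finset (Fin 3 → Fin (qOf m)) := by
  classical exact T.filter fun c' => c' ≠ c ∧ cellEmb m c' p = cellEmb m c p

/-- Membership in the co-curves. [this file] -/
theorem mem_coCurves {T : Finset (Fin 3 → Fin (qOf m))} {c c' : Fin 3 → Fin (qOf m)}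
    {p : Fin m × Fin m} :
    c' ∈ coCurves T c p ↔ c' ∈ T ∧ c' ≠ c ∧ cellEmb m c' p = cellEmb m c p := by
  classical
  simp [coCurves]

/-- Two distinct blocks agree at no more than two positions (they share at most two cells).
[this file] -/
theorem card_filter_pos_eq_le {c c' : Fin 3 → Fin (qOf m)} (hcc' : c' ≠ c) :
    ((Finset.univ : Finset (Fin m × Fin m)).filter
      fun p => cellEmb m c' p = cellEmb m c p).card ≤ 2 := by
  classical
  have hD := subDesign_isNWDesign m hcc'
  refine le_trans ?_ hD
  rw [← Finset.card_map (cellEmb m c)]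
  refine Finset.card_le_card fun x hx => ?_
  obtain ⟨p, hp, rfl⟩ := Finset.mem_map.mp hx
  have hp' := (Finset.mem_filter.mp hp).2
  exact Finset.mem_inter.mpr
    ⟨Finset.mem_map.mpr ⟨p, Finset.mem_univ _, hp'⟩, Finset.mem_map.mpr ⟨p, Finset.mem_univ _, rfl⟩⟩

/-- **Incidence count.** Summed over the positions of the block of `c`, the co-curve numbers do
not exceed `2 (#T − 1)` (for `c ∈ T`; `2 #T` in general). [this file] -/
theorem sum_card_coCurves_le (T : Finset (Fin 3 → Fin (qOf m))) (c : Fin 3 → Fin (qOf m)) :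
    ∑ p : Fin m × Fin m, (coCurves T c p).card ≤ 2 * (T.erase c).card := by
  classical
  -- double counting: `Σ_p #coCurves = Σ_{c' ∈ T \ c} #{p : agreement at p} ≤ Σ 2`
  have h1 : ∑ p : Fin m × Fin m, (coCurves T c p).card =
      ∑ c' ∈ T.erase c, ((Finset.univ : Finset (Fin m × Fin m)).filter
        fun p => cellEmb m c' p = cellEmb m c p).card := by
    simp only [coCurves, Finset.card_filter]
    rw [Finset.sum_comm]
    refine (Finset.sum_subset (Finset.erase_subset c T) fun c' hc'T hc' => ?_).symm.trans ?_
    · have : c' = c := by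
        by_contra h
        exact hc' (Finset.mem_erase.mpr ⟨h, hc'T⟩)
      simp [this]
    · refine Finset.sum_congr rfl fun c' hc' => Finset.sum_congr rfl fun p _ => ?_
      have hne : c' ≠ c := Finset.ne_of_mem_erase hc'
      by_cases h : cellEmb m c' p = cellEmb m c p
      · simp [h, hne]
      · simp [h]
  rw [h1]
  have h2 := Finset.sum_le_card_nsmul (T.erase c)
    (fun c' => ((Finset.univ : Finset (Fin m × Fin m)).filter
      fun p => cellEmb m c' p = cellEmb m c p).card) 2
    fun c' hc' => card_filter_pos_eq_le (Finset.ne_of_mem_erase hc')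
  rw [smul_eq_mul] at h2
  omega

/-! ## 2. Heavy cells and heavy rows are few -/

/-- The `M`-HEAVY positions of `c`: at least `M` co-curves. [this file] -/
def heavyCells (T : Finset (Fin 3 → Fin (qOf m))) (c : Fin 3 → Fin (qOf m)) (M : ℕ) :
    Finset (Fin m × Fin m) :=
  univ.filter fun p => M ≤ (coCurves T c p).card

/-- The HEAVY ROWS of `c`: rows containing an `M`-heavy position. [this file] -/
def heavyRows (T : Finset (Fin 3 → Fin (qOf m))) (c : Fin 3 → Fin (qOf m)) (M : ℕ) :
    Finset (Fin m) :=
  (heavyCells T c M).image Prod.fst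

/-- Membership in the heavy positions. [this file] -/
theorem mem_heavyCells {T : Finset (Fin 3 → Fin (qOf m))} {c : Fin 3 → Fin (qOf m)} {M : ℕ}
    {p : Fin m × Fin m} : p ∈ heavyCells T c M ↔ M ≤ (coCurves T c p).card := by
  simp [heavyCells]

/-- Membership in the heavy rows. [this file] -/
theorem mem_heavyRows {T : Finset (Fin 3 → Fin (qOf m))} {c : Fin 3 → Fin (qOf m)} {M : ℕ}
    {i : Fin m} : i ∈ heavyRows T c M ↔ ∃ j, M ≤ (coCurves T c (i, j)).card := by
  simp [heavyRows, mem_heavyCells]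

/-- **Few heavy cells**: `M · #heavyCells ≤ 2 (#T − 1)`. [this file] -/
theorem mul_card_heavyCells_le (T : Finset (Fin 3 → Fin (qOf m))) (c : Fin 3 → Fin (qOf m))
    (M : ℕ) : M * (heavyCells T c M).card ≤ 2 * (T.erase c).card := by
  classical
  refine le_trans ?_ (sum_card_coCurves_le T c)
  have h1 := Finset.card_nsmul_le_sum (heavyCells T c M) (fun p => (coCurves T c p).card) M
    fun p hp => mem_heavyCells.mp hp
  rw [smul_eq_mul, mul_comm] at h1
  exact h1.trans (Finset.sum_le_sum_of_subset_of_nonneg (Finset.subset_univ _) fun _ _ _ =>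
    Nat.zero_le _)

/-- **Few heavy rows**: `M · #heavyRows ≤ 2 (#T − 1)`. [this file] -/
theorem mul_card_heavyRows_le (T : Finset (Fin 3 → Fin (qOf m))) (c : Fin 3 → Fin (qOf m))
    (M : ℕ) : M * (heavyRows T c M).card ≤ 2 * (T.erase c).card :=
  (Nat.mul_le_mul_left M Finset.card_image_le).trans (mul_card_heavyCells_le T c M)

/-- **Many admissible rows**: if `M · k ≥ 2 #T`, at least `m − k` rows of `c` are free of
`M`-heavy cells. [this file] -/
theorem le_card_compl_heavyRows (T : Finset (Fin 3 → Fin (qOf m))) (c : Fin 3 → Fin (qOf m))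
    {M k : ℕ} (hM : 2 * T.card ≤ M * k) (hMpos : 0 < M) : m - k ≤ ((heavyRows T c M)ᶜ).card := by
  classical
  have h1 := mul_card_heavyRows_le T c M
  have h2 : (T.erase c).card ≤ T.card := Finset.card_le_card (Finset.erase_subset _ _)
  have h3 : (heavyRows T c M).card ≤ k := by
    by_contra h
    have : M * (k + 1) ≤ M * (heavyRows T c M).card := Nat.mul_le_mul_left M (by omega)
    nlinarith
  rw [Finset.card_compl, Fintype.card_fin]
  omega

/-! ## 3. Self-protection: heavy cells are never gadget zeros under the row rule -/

/-- Heaviness is a property of the cell: a co-curve of `c` at `p` has the same co-curve count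
at `p`. [this file] -/
theorem card_coCurves_eq_of_mem {T : Finset (Fin 3 → Fin (qOf m))} {c c' : Fin 3 → Fin (qOf m)}
    (hc : c ∈ T) {p : Fin m × Fin m} (hc' : c' ∈ coCurves T c p) :
    (coCurves T c' p).card = (coCurves T c p).card := by
  classical
  obtain ⟨hc'T, hne, he⟩ := mem_coCurves.mp hc'
  -- both are `{c'' ∈ T : cell of c'' at p = x}` with one element (itself) removed
  have h1 : coCurves T c' p = (T.filter fun c'' => cellEmb m c'' p = cellEmb m c p).erase c' := by
    ext c''
    simp only [mem_coCurves, Finset.mem_erase, Finset.mem_filter, he]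
    tauto
  have h2 : coCurves T c p = (T.filter fun c'' => cellEmb m c'' p = cellEmb m c p).erase c := by
    ext c''
    simp only [mem_coCurves, Finset.mem_erase, Finset.mem_filter]
    tauto
  have hcm : c ∈ T.filter (fun c'' => cellEmb m c'' p = cellEmb m c p) :=
    Finset.mem_filter.mpr ⟨hc, rfl⟩
  have hc'm : c' ∈ T.filter (fun c'' => cellEmb m c'' p = cellEmb m c p) :=
    Finset.mem_filter.mpr ⟨hc'T, he⟩
  rw [h1, h2, Finset.card_erase_of_mem hc'm, Finset.card_erase_of_mem hcm]

/-- **Self-protection.** If no curve of `T` pivots in one of its own `M`-heavy rows, then an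
`M`-heavy cell of a curve `c ∈ T` off its pivot row is never a gadget zero. [this file] -/
theorem not_mem_pivotZeros_of_heavy (T : Finset (Fin 3 → Fin (qOf m))) (s₀ : Fin m)
    (r : (Fin 3 → Fin (qOf m)) → Fin m) (M : ℕ) (hrule : ∀ c' ∈ T, r c' ∉ heavyRows T c' M)
    {c : Fin 3 → Fin (qOf m)} (hc : c ∈ T) {i j : Fin m} (hi : i ≠ r c)
    (hheavy : M ≤ (coCurves T c (i, j)).card) : cellEmb m c (i, j) ∉ pivotZeros m T s₀ r := by
  intro hW
  obtain ⟨c', hc'T, hne, hrow, he⟩ := exists_of_mem_pivotZeros hi hW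
  have hc' : c' ∈ coCurves T c (i, j) := mem_coCurves.mpr ⟨hc'T, hne, he⟩
  refine hrule c' hc'T (mem_heavyRows.mpr ⟨j, ?_⟩)
  rw [hrow, card_coCurves_eq_of_mem hc hc']
  exact hheavy

/-- Hence, under the row rule, every killed cell of `c` off its pivot row is LIGHT (fewer than
`M` co-curves). [this file] -/
theorem card_coCurves_lt_of_mem_pivotZeros (T : Finset (Fin 3 → Fin (qOf m))) (s₀ : Fin m)
    (r : (Fin 3 → Fin (qOf m)) → Fin m) (M : ℕ) (hrule : ∀ c' ∈ T, r c' ∉ heavyRows T c' M)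
    {c : Fin 3 → Fin (qOf m)} (hc : c ∈ T) {i j : Fin m} (hi : i ≠ r c)
    (hW : cellEmb m c (i, j) ∈ pivotZeros m T s₀ r) : (coCurves T c (i, j)).card < M := by
  by_contra h
  exact not_mem_pivotZeros_of_heavy T s₀ r M hrule hc hi (not_lt.mp h) hW

end Summit.ValiantsHypothesis.ValiantsHypothesis.Theorems.DefinabilityGapPivotAdmissible
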